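import Summits.ValiantsHypothesis.ValiantsHypothesis.Theorems.LacunarySymmetroidMatrixDescartesCensusDoorA34NineInertia

/-!
# `MatrixDescartes` census — DOOR A at `(3,4)`: the NINE-ROW LETTER INERTIA TABLE, part 2 (sign and inertia tables, all supports, any definite bottom letter)

HONEST FRAMING.  Object-search cell `pub-symmetroid`, door-A seat `val-sym-door-p3` (g16); helper file beside the OPEN typed statement
`DoorA34 = PosRootLawAt 3 4 18` (route item `Theses.LacunarySymmetroid.DoorA34`, stmt-ValiantsHypothesis-19980), asserted nowhere here.
Companion of `…CensusDoorA34NineInertia` (part 1: nine positive roots ⇒ ten monomials, the coefficient dictionary, the one-step Descartes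
lemma `NineInertia.sign_step`, the chamber walls `NineInertia.walls_of_nine`).  Here, for a real `3 × 3` three-letter pencil
`F = S 0 + X^(d 1) S 1 + X^(d 2) S 2` with `d 0 = 0` and NINE distinct positive det-roots — NO normalisation of the letters —

* `signs_chamber_I/II/III/IV` (any real letters with `det S₀ > 0`; by `S ↦ −S` this is no restriction): the signs of the nine invariants
  `tr(adj S₀·S₁), tr(adj S₁·S₀), det S₁, tr(adj S₀·S₂), tr(adj S₂·S₀), det S₂, tr(adj S₁·S₂), tr(adj S₂·S₁)` and of the polarised mixed
  coefficient are FORCED by the chamber of `d 2 / d 1` in `(3,∞) / (2,3) / (3/2,2) / (1,3/2)` (full alternation along the chamber's order of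
  the ten exponents `3d₀, 2d₀+d₁, …`; symmetry not used);
* `posDef_of_pencil_invariants_pos` (`S₀ ≻ 0`, `M` symmetric, `tr(adj S₀·M), tr(adj M·S₀), det M > 0 ⇒ M ≻ 0`: the pencil `det(S₀ + tM)`
  has no positive root, then `Census.posDef_of_forall_det_add_smul_ne_zero`), and the two trace obstructions `not_posDef_of_trace_adjugate_mul_nonpos`,
  `not_neg_posDef_of_…` (Schur: `tr(P·Q) > 0` for `P, Q ≻ 0`);
* `inertia_chamber_I/II/III/IV` (symmetric letters, `S₀ ≻ 0` — the definite-bottom-letter source row of the flag ladder, cf.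
  `Census.FlagInertia.no_flag_of_indefinite_letter`): chamber I `−S₁ ≻ 0` and `S₂` of inertia `(2,1)`; II `S₁` `(1,2)`, `S₂` `(2,1)`;
  III (the pure-λ_min chamber `κ = d₁/(d₂−d₁) ∈ (1,2)`) both `(2,1)`; IV `S₁` `(1,2)`, `S₂` `(2,1)` — inertia `(2,1)` typed as
  `det < 0 ∧ ¬(−S) ≻ 0`, `(1,2)` as `0 < det ∧ ¬ S ≻ 0` (for `3 × 3` these are the index statements);
* `top_letter_inertia` / `middle_letter_not_posDef` — the chamber-free summary rows: with a positive definite bottom letter the TOP letter of a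
  nine-row always has inertia `(2,1)` (g8's located «n₋(S₂) = 1 always», now a theorem) and the MIDDLE letter is never positive definite.

Nothing here bounds `ζ_sym(3,3)` or `ζ_sym(3,4)`; `DoorA34`, Claim L («no pure-λ_min nine») and `MatrixDescartes` (stmt-ValiantsHypothesis-18050)
stay OPEN; nothing on `VP ≠ VNP`.
[folklore] Descartes' rule of signs (sharp case), the spectral theorem for real symmetric matrices, Schur's product theorem; elementary.
-/

open Polynomial Finset Matrix

-- `Summit.ValiantsHypothesis.ValiantsHypothesis.…` repeats a component by the D-0017 layout
-- (single-conjunct summit), which the `dupNamespace` linter flags; the name is mandated.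
set_option linter.dupNamespace false

namespace Summit.ValiantsHypothesis.ValiantsHypothesis.Theorems.LacunarySymmetroidMatrixDescartes.Census

namespace NineInertia

open scoped BigOperators Polynomial Matrix

/-! ## 1. THE SIGN TABLES per chamber (any real letters, `d 0 = 0`, `det S₀ > 0`) -/

section SignTables

variable (d : Fin 3 → ℕ) (S : Fin 3 → Matrix (Fin 3) (Fin 3) ℝ)
  (h9 : 9 ≤ ((Matrix.det (∑ l, ((X : ℝ[X]) ^ d l) • (S l).map C)).roots.toFinset.filter (fun t => 0 < t)).card)
  (h0 : d 0 = 0) (hdet : 0 < (S 0).det)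
include h9 h0

/-- The nine non-constant coefficients of a nine-row with `d 0 = 0`, as letter invariants (no normalisation): `coeff d₁ = tr(adj S₀·S₁)`,
`coeff 2d₁ = tr(adj S₁·S₀)`, `coeff 3d₁ = det S₁`, `coeff d₂ = tr(adj S₀·S₂)`, `coeff (d₁+d₂) =` polarised mixed determinant,
`coeff (2d₁+d₂) = tr(adj S₁·S₂)`, `coeff 2d₂ = tr(adj S₂·S₀)`, `coeff (2d₂+d₁) = tr(adj S₂·S₁)`, `coeff 3d₂ = det S₂`; and `coeff 0 = det S₀`.
[folklore] -/
theorem coeff_table :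
    (Matrix.det (∑ l, ((X : ℝ[X]) ^ d l) • (S l).map C)).coeff 0 = (S 0).det ∧
    (Matrix.det (∑ l, ((X : ℝ[X]) ^ d l) • (S l).map C)).coeff (d 1) = ((S 0).adjugate * S 1).trace ∧
    (Matrix.det (∑ l, ((X : ℝ[X]) ^ d l) • (S l).map C)).coeff (2 * d 1) = ((S 1).adjugate * S 0).trace ∧
    (Matrix.det (∑ l, ((X : ℝ[X]) ^ d l) • (S l).map C)).coeff (3 * d 1) = (S 1).det ∧
    (Matrix.det (∑ l, ((X : ℝ[X]) ^ d l) • (S l).map C)).coeff (d 2) = ((S 0).adjugate * S 2).trace ∧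
    (Matrix.det (∑ l, ((X : ℝ[X]) ^ d l) • (S l).map C)).coeff (d 1 + d 2)
      = (((S 0 + S 1).adjugate - (S 0).adjugate - (S 1).adjugate) * S 2).trace ∧
    (Matrix.det (∑ l, ((X : ℝ[X]) ^ d l) • (S l).map C)).coeff (2 * d 1 + d 2) = ((S 1).adjugate * S 2).trace ∧
    (Matrix.det (∑ l, ((X : ℝ[X]) ^ d l) • (S l).map C)).coeff (2 * d 2) = ((S 2).adjugate * S 0).trace ∧
    (Matrix.det (∑ l, ((X : ℝ[X]) ^ d l) • (S l).map C)).coeff (2 * d 2 + d 1) = ((S 2).adjugate * S 1).trace ∧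
    (Matrix.det (∑ l, ((X : ℝ[X]) ^ d l) • (S l).map C)).coeff (3 * d 2) = (S 2).det := by
  have c0 := coeff_cube d S h9 0
  rw [h0, mul_zero] at c0
  have c1 := coeff_square d S h9 (i := 0) (k := 1) (by decide)
  rw [h0, mul_zero, zero_add] at c1
  have c2 := coeff_square d S h9 (i := 1) (k := 0) (by decide)
  rw [h0, add_zero] at c2
  have c3 := coeff_cube d S h9 1
  have c4 := coeff_square d S h9 (i := 0) (k := 2) (by decide)
  rw [h0, mul_zero, zero_add] at c4
  have c5 := coeff_mixed d S h9
  rw [h0, zero_add] at c5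
  have c6 := coeff_square d S h9 (i := 1) (k := 2) (by decide)
  have c7 := coeff_square d S h9 (i := 2) (k := 0) (by decide)
  rw [h0, add_zero] at c7
  have c8 := coeff_square d S h9 (i := 2) (k := 1) (by decide)
  have c9 := coeff_cube d S h9 2
  exact ⟨c0, c1, c2, c3, c4, c5, c6, c7, c8, c9⟩

include hdet

/-- **THE SIGN TABLE, chamber I (`3d₁ < d₂`; order `0,d₁,2d₁,3d₁,d₂,d₁+d₂,2d₁+d₂,2d₂,2d₂+d₁,3d₂`)**: with `det S₀ > 0` a nine-row has
`tr(adj S₀·S₁) < 0 < tr(adj S₁·S₀)`, `det S₁ < 0 < tr(adj S₀·S₂)`, mixed `< 0 < tr(adj S₁·S₂)`, `tr(adj S₂·S₀) < 0 < tr(adj S₂·S₁)`, `det S₂ < 0`.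
[folklore] -/
theorem signs_chamber_I (hI : 3 * d 1 < d 2) (h1 : 0 < d 1) :
    ((S 0).adjugate * S 1).trace < 0 ∧
    0 < ((S 1).adjugate * S 0).trace ∧
    (S 1).det < 0 ∧
    0 < ((S 0).adjugate * S 2).trace ∧
    (((S 0 + S 1).adjugate - (S 0).adjugate - (S 1).adjugate) * S 2).trace < 0 ∧
    0 < ((S 1).adjugate * S 2).trace ∧
    ((S 2).adjugate * S 0).trace < 0 ∧
    0 < ((S 2).adjugate * S 1).trace ∧
    (S 2).det < 0 := by
  obtain ⟨m0, m1, m2, m3, m4, m5, m6, m7, m8, m9⟩ := mem_support_ten d S h9 h0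
  have gap := fun c hc => exponent_cases d S h0 (c := c) hc
  obtain ⟨c0, c1, c2, c3, c4, c5, c6, c7, c8, c9⟩ := coeff_table d S h9 h0
  -- exponent order: 0, d1, 2d1, 3d1, d2, d1+d2, 2d1+d2, 2d2, 2d2+d1, 3d2
  have s1 := sign_step d S h9 m0 m1 (by omega) (fun c hc => by rcases gap c hc with h|h|h|h|h|h|h|h|h|h <;> omega)
  have s2 := sign_step d S h9 m1 m2 (by omega) (fun c hc => by rcases gap c hc with h|h|h|h|h|h|h|h|h|h <;> omega)
  have s3 := sign_step d S h9 m2 m3 (by omega) (fun c hc => by rcases gap c hc with h|h|h|h|h|h|h|h|h|h <;> omega)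
  have s4 := sign_step d S h9 m3 m4 (by omega) (fun c hc => by rcases gap c hc with h|h|h|h|h|h|h|h|h|h <;> omega)
  have s5 := sign_step d S h9 m4 m5 (by omega) (fun c hc => by rcases gap c hc with h|h|h|h|h|h|h|h|h|h <;> omega)
  have s6 := sign_step d S h9 m5 m6 (by omega) (fun c hc => by rcases gap c hc with h|h|h|h|h|h|h|h|h|h <;> omega)
  have s7 := sign_step d S h9 m6 m7 (by omega) (fun c hc => by rcases gap c hc with h|h|h|h|h|h|h|h|h|h <;> omega)
  have s8 := sign_step d S h9 m7 m8 (by omega) (fun c hc => by rcases gap c hc with h|h|h|h|h|h|h|h|h|h <;> omega)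
  have s9 := sign_step d S h9 m8 m9 (by omega) (fun c hc => by rcases gap c hc with h|h|h|h|h|h|h|h|h|h <;> omega)
  rw [c0, c1] at s1; rw [c1, c2] at s2; rw [c2, c3] at s3; rw [c3, c4] at s4; rw [c4, c5] at s5; rw [c5, c6] at s6; rw [c6, c7] at s7; rw [c7, c8] at s8; rw [c8, c9] at s9
  have t1 : ((S 0).adjugate * S 1).trace < 0 := neg_of_mul_neg_right s1 hdet.le
  have t2 : 0 < ((S 1).adjugate * S 0).trace := pos_of_mul_neg_right s2 t1.le
  have t3 : (S 1).det < 0 := neg_of_mul_neg_right s3 t2.le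
  have t4 : 0 < ((S 0).adjugate * S 2).trace := pos_of_mul_neg_right s4 t3.le
  have t5 : (((S 0 + S 1).adjugate - (S 0).adjugate - (S 1).adjugate) * S 2).trace < 0 := neg_of_mul_neg_right s5 t4.le
  have t6 : 0 < ((S 1).adjugate * S 2).trace := pos_of_mul_neg_right s6 t5.le
  have t7 : ((S 2).adjugate * S 0).trace < 0 := neg_of_mul_neg_right s7 t6.le
  have t8 : 0 < ((S 2).adjugate * S 1).trace := pos_of_mul_neg_right s8 t7.le
  have t9 : (S 2).det < 0 := neg_of_mul_neg_right s9 t8.le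
  exact ⟨t1, t2, t3, t4, t5, t6, t7, t8, t9⟩

/-- **THE SIGN TABLE, chamber II (`2d₁ < d₂ < 3d₁`; order `0,d₁,2d₁,d₂,3d₁,d₁+d₂,2d₁+d₂,2d₂,2d₂+d₁,3d₂`)**: `tr(adj S₀·S₁) < 0 < tr(adj S₁·S₀)`,
`tr(adj S₀·S₂) < 0 < det S₁`, mixed `< 0 < tr(adj S₁·S₂)`, `tr(adj S₂·S₀) < 0 < tr(adj S₂·S₁)`, `det S₂ < 0`. [folklore] -/
theorem signs_chamber_II (hIIa : 2 * d 1 < d 2) (hIIb : d 2 < 3 * d 1) :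
    ((S 0).adjugate * S 1).trace < 0 ∧
    0 < ((S 1).adjugate * S 0).trace ∧
    ((S 0).adjugate * S 2).trace < 0 ∧
    0 < (S 1).det ∧
    (((S 0 + S 1).adjugate - (S 0).adjugate - (S 1).adjugate) * S 2).trace < 0 ∧
    0 < ((S 1).adjugate * S 2).trace ∧
    ((S 2).adjugate * S 0).trace < 0 ∧
    0 < ((S 2).adjugate * S 1).trace ∧
    (S 2).det < 0 := by
  obtain ⟨m0, m1, m2, m3, m4, m5, m6, m7, m8, m9⟩ := mem_support_ten d S h9 h0
  have gap := fun c hc => exponent_cases d S h0 (c := c) hc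
  obtain ⟨c0, c1, c2, c3, c4, c5, c6, c7, c8, c9⟩ := coeff_table d S h9 h0
  -- exponent order: 0, d1, 2d1, d2, 3d1, d1+d2, 2d1+d2, 2d2, 2d2+d1, 3d2
  have s1 := sign_step d S h9 m0 m1 (by omega) (fun c hc => by rcases gap c hc with h|h|h|h|h|h|h|h|h|h <;> omega)
  have s2 := sign_step d S h9 m1 m2 (by omega) (fun c hc => by rcases gap c hc with h|h|h|h|h|h|h|h|h|h <;> omega)
  have s3 := sign_step d S h9 m2 m4 (by omega) (fun c hc => by rcases gap c hc with h|h|h|h|h|h|h|h|h|h <;> omega)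
  have s4 := sign_step d S h9 m4 m3 (by omega) (fun c hc => by rcases gap c hc with h|h|h|h|h|h|h|h|h|h <;> omega)
  have s5 := sign_step d S h9 m3 m5 (by omega) (fun c hc => by rcases gap c hc with h|h|h|h|h|h|h|h|h|h <;> omega)
  have s6 := sign_step d S h9 m5 m6 (by omega) (fun c hc => by rcases gap c hc with h|h|h|h|h|h|h|h|h|h <;> omega)
  have s7 := sign_step d S h9 m6 m7 (by omega) (fun c hc => by rcases gap c hc with h|h|h|h|h|h|h|h|h|h <;> omega)
  have s8 := sign_step d S h9 m7 m8 (by omega) (fun c hc => by rcases gap c hc with h|h|h|h|h|h|h|h|h|h <;> omega)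
  have s9 := sign_step d S h9 m8 m9 (by omega) (fun c hc => by rcases gap c hc with h|h|h|h|h|h|h|h|h|h <;> omega)
  rw [c0, c1] at s1; rw [c1, c2] at s2; rw [c2, c4] at s3; rw [c4, c3] at s4; rw [c3, c5] at s5; rw [c5, c6] at s6; rw [c6, c7] at s7; rw [c7, c8] at s8; rw [c8, c9] at s9
  have t1 : ((S 0).adjugate * S 1).trace < 0 := neg_of_mul_neg_right s1 hdet.le
  have t2 : 0 < ((S 1).adjugate * S 0).trace := pos_of_mul_neg_right s2 t1.le
  have t3 : ((S 0).adjugate * S 2).trace < 0 := neg_of_mul_neg_right s3 t2.le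
  have t4 : 0 < (S 1).det := pos_of_mul_neg_right s4 t3.le
  have t5 : (((S 0 + S 1).adjugate - (S 0).adjugate - (S 1).adjugate) * S 2).trace < 0 := neg_of_mul_neg_right s5 t4.le
  have t6 : 0 < ((S 1).adjugate * S 2).trace := pos_of_mul_neg_right s6 t5.le
  have t7 : ((S 2).adjugate * S 0).trace < 0 := neg_of_mul_neg_right s7 t6.le
  have t8 : 0 < ((S 2).adjugate * S 1).trace := pos_of_mul_neg_right s8 t7.le
  have t9 : (S 2).det < 0 := neg_of_mul_neg_right s9 t8.le
  exact ⟨t1, t2, t3, t4, t5, t6, t7, t8, t9⟩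

/-- **THE SIGN TABLE, chamber III (`3d₁ < 2d₂`, `d₂ < 2d₁`; order `0,d₁,d₂,2d₁,d₁+d₂,3d₁,2d₂,2d₁+d₂,2d₂+d₁,3d₂`)** — the chamber of the
pure-λ_min question (`κ = d₁/(d₂−d₁) ∈ (1,2)`): `tr(adj S₀·S₁) < 0 < tr(adj S₀·S₂)`, `tr(adj S₁·S₀) < 0 <` mixed, `det S₁ < 0 < tr(adj S₂·S₀)`,
`tr(adj S₁·S₂) < 0 < tr(adj S₂·S₁)`, `det S₂ < 0`. [folklore] -/
theorem signs_chamber_III (hIIIa : 3 * d 1 < 2 * d 2) (hIIIb : d 2 < 2 * d 1) :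
    ((S 0).adjugate * S 1).trace < 0 ∧
    0 < ((S 0).adjugate * S 2).trace ∧
    ((S 1).adjugate * S 0).trace < 0 ∧
    0 < (((S 0 + S 1).adjugate - (S 0).adjugate - (S 1).adjugate) * S 2).trace ∧
    (S 1).det < 0 ∧
    0 < ((S 2).adjugate * S 0).trace ∧
    ((S 1).adjugate * S 2).trace < 0 ∧
    0 < ((S 2).adjugate * S 1).trace ∧
    (S 2).det < 0 := by
  obtain ⟨m0, m1, m2, m3, m4, m5, m6, m7, m8, m9⟩ := mem_support_ten d S h9 h0
  have gap := fun c hc => exponent_cases d S h0 (c := c) hc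
  obtain ⟨c0, c1, c2, c3, c4, c5, c6, c7, c8, c9⟩ := coeff_table d S h9 h0
  -- exponent order: 0, d1, d2, 2d1, d1+d2, 3d1, 2d2, 2d1+d2, 2d2+d1, 3d2
  have s1 := sign_step d S h9 m0 m1 (by omega) (fun c hc => by rcases gap c hc with h|h|h|h|h|h|h|h|h|h <;> omega)
  have s2 := sign_step d S h9 m1 m4 (by omega) (fun c hc => by rcases gap c hc with h|h|h|h|h|h|h|h|h|h <;> omega)
  have s3 := sign_step d S h9 m4 m2 (by omega) (fun c hc => by rcases gap c hc with h|h|h|h|h|h|h|h|h|h <;> omega)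
  have s4 := sign_step d S h9 m2 m5 (by omega) (fun c hc => by rcases gap c hc with h|h|h|h|h|h|h|h|h|h <;> omega)
  have s5 := sign_step d S h9 m5 m3 (by omega) (fun c hc => by rcases gap c hc with h|h|h|h|h|h|h|h|h|h <;> omega)
  have s6 := sign_step d S h9 m3 m7 (by omega) (fun c hc => by rcases gap c hc with h|h|h|h|h|h|h|h|h|h <;> omega)
  have s7 := sign_step d S h9 m7 m6 (by omega) (fun c hc => by rcases gap c hc with h|h|h|h|h|h|h|h|h|h <;> omega)
  have s8 := sign_step d S h9 m6 m8 (by omega) (fun c hc => by rcases gap c hc with h|h|h|h|h|h|h|h|h|h <;> omega)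
  have s9 := sign_step d S h9 m8 m9 (by omega) (fun c hc => by rcases gap c hc with h|h|h|h|h|h|h|h|h|h <;> omega)
  rw [c0, c1] at s1; rw [c1, c4] at s2; rw [c4, c2] at s3; rw [c2, c5] at s4; rw [c5, c3] at s5; rw [c3, c7] at s6; rw [c7, c6] at s7; rw [c6, c8] at s8; rw [c8, c9] at s9
  have t1 : ((S 0).adjugate * S 1).trace < 0 := neg_of_mul_neg_right s1 hdet.le
  have t2 : 0 < ((S 0).adjugate * S 2).trace := pos_of_mul_neg_right s2 t1.le
  have t3 : ((S 1).adjugate * S 0).trace < 0 := neg_of_mul_neg_right s3 t2.le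
  have t4 : 0 < (((S 0 + S 1).adjugate - (S 0).adjugate - (S 1).adjugate) * S 2).trace := pos_of_mul_neg_right s4 t3.le
  have t5 : (S 1).det < 0 := neg_of_mul_neg_right s5 t4.le
  have t6 : 0 < ((S 2).adjugate * S 0).trace := pos_of_mul_neg_right s6 t5.le
  have t7 : ((S 1).adjugate * S 2).trace < 0 := neg_of_mul_neg_right s7 t6.le
  have t8 : 0 < ((S 2).adjugate * S 1).trace := pos_of_mul_neg_right s8 t7.le
  have t9 : (S 2).det < 0 := neg_of_mul_neg_right s9 t8.le
  exact ⟨t1, t2, t3, t4, t5, t6, t7, t8, t9⟩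

/-- **THE SIGN TABLE, chamber IV (`d₁ < d₂`, `2d₂ < 3d₁`; order `0,d₁,d₂,2d₁,d₁+d₂,2d₂,3d₁,2d₁+d₂,2d₂+d₁,3d₂`)**: `tr(adj S₀·S₁) < 0 <
tr(adj S₀·S₂)`, `tr(adj S₁·S₀) < 0 <` mixed, `tr(adj S₂·S₀) < 0 < det S₁`, `tr(adj S₁·S₂) < 0 < tr(adj S₂·S₁)`, `det S₂ < 0`. [folklore] -/
theorem signs_chamber_IV (h12 : d 1 < d 2) (hIV : 2 * d 2 < 3 * d 1) :
    ((S 0).adjugate * S 1).trace < 0 ∧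
    0 < ((S 0).adjugate * S 2).trace ∧
    ((S 1).adjugate * S 0).trace < 0 ∧
    0 < (((S 0 + S 1).adjugate - (S 0).adjugate - (S 1).adjugate) * S 2).trace ∧
    ((S 2).adjugate * S 0).trace < 0 ∧
    0 < (S 1).det ∧
    ((S 1).adjugate * S 2).trace < 0 ∧
    0 < ((S 2).adjugate * S 1).trace ∧
    (S 2).det < 0 := by
  obtain ⟨m0, m1, m2, m3, m4, m5, m6, m7, m8, m9⟩ := mem_support_ten d S h9 h0
  have gap := fun c hc => exponent_cases d S h0 (c := c) hc
  obtain ⟨c0, c1, c2, c3, c4, c5, c6, c7, c8, c9⟩ := coeff_table d S h9 h0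
  -- exponent order: 0, d1, d2, 2d1, d1+d2, 2d2, 3d1, 2d1+d2, 2d2+d1, 3d2
  have s1 := sign_step d S h9 m0 m1 (by omega) (fun c hc => by rcases gap c hc with h|h|h|h|h|h|h|h|h|h <;> omega)
  have s2 := sign_step d S h9 m1 m4 (by omega) (fun c hc => by rcases gap c hc with h|h|h|h|h|h|h|h|h|h <;> omega)
  have s3 := sign_step d S h9 m4 m2 (by omega) (fun c hc => by rcases gap c hc with h|h|h|h|h|h|h|h|h|h <;> omega)
  have s4 := sign_step d S h9 m2 m5 (by omega) (fun c hc => by rcases gap c hc with h|h|h|h|h|h|h|h|h|h <;> omega)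
  have s5 := sign_step d S h9 m5 m7 (by omega) (fun c hc => by rcases gap c hc with h|h|h|h|h|h|h|h|h|h <;> omega)
  have s6 := sign_step d S h9 m7 m3 (by omega) (fun c hc => by rcases gap c hc with h|h|h|h|h|h|h|h|h|h <;> omega)
  have s7 := sign_step d S h9 m3 m6 (by omega) (fun c hc => by rcases gap c hc with h|h|h|h|h|h|h|h|h|h <;> omega)
  have s8 := sign_step d S h9 m6 m8 (by omega) (fun c hc => by rcases gap c hc with h|h|h|h|h|h|h|h|h|h <;> omega)
  have s9 := sign_step d S h9 m8 m9 (by omega) (fun c hc => by rcases gap c hc with h|h|h|h|h|h|h|h|h|h <;> omega)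
  rw [c0, c1] at s1; rw [c1, c4] at s2; rw [c4, c2] at s3; rw [c2, c5] at s4; rw [c5, c7] at s5; rw [c7, c3] at s6; rw [c3, c6] at s7; rw [c6, c8] at s8; rw [c8, c9] at s9
  have t1 : ((S 0).adjugate * S 1).trace < 0 := neg_of_mul_neg_right s1 hdet.le
  have t2 : 0 < ((S 0).adjugate * S 2).trace := pos_of_mul_neg_right s2 t1.le
  have t3 : ((S 1).adjugate * S 0).trace < 0 := neg_of_mul_neg_right s3 t2.le
  have t4 : 0 < (((S 0 + S 1).adjugate - (S 0).adjugate - (S 1).adjugate) * S 2).trace := pos_of_mul_neg_right s4 t3.le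
  have t5 : ((S 2).adjugate * S 0).trace < 0 := neg_of_mul_neg_right s5 t4.le
  have t6 : 0 < (S 1).det := pos_of_mul_neg_right s6 t5.le
  have t7 : ((S 1).adjugate * S 2).trace < 0 := neg_of_mul_neg_right s7 t6.le
  have t8 : 0 < ((S 2).adjugate * S 1).trace := pos_of_mul_neg_right s8 t7.le
  have t9 : (S 2).det < 0 := neg_of_mul_neg_right s9 t8.le
  exact ⟨t1, t2, t3, t4, t5, t6, t7, t8, t9⟩

end SignTables

/-! ## 2. From pencil invariants to definiteness (`3 × 3` real symmetric, any positive definite base) -/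

/-- **Positive pencil invariants ⇒ positive definite.**  For `S₀ ≻ 0` and `M` real symmetric `3 × 3` with `tr(adj S₀·M) > 0`,
`tr(adj M·S₀) > 0`, `det M > 0`: the pencil `det(S₀ + t·M) = det S₀ + t·tr(adj S₀·M) + t²·tr(adj M·S₀) + t³·det M` has no positive root,
so `M ≻ 0` by `Census.posDef_of_forall_det_add_smul_ne_zero` (definiteness propagates along a root-free ray).  At `S₀ = 1` this is
«`tr, e₂, det > 0 ⇒ ≻ 0`». [folklore] -/
theorem posDef_of_pencil_invariants_pos {S₀ M : Matrix (Fin 3) (Fin 3) ℝ} (hP : S₀.PosDef) (hM : M.IsSymm)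
    (h1 : 0 < (S₀.adjugate * M).trace) (h2 : 0 < (M.adjugate * S₀).trace) (h3 : 0 < M.det) : M.PosDef := by
  have hH : M.IsHermitian := Matrix.isHermitian_iff_isSymm.2 hM
  refine posDef_of_forall_det_add_smul_ne_zero hP hH h3.ne' fun t ht => ?_
  rw [det_add_smul_fin_three]
  have hd := hP.det_pos
  positivity

/-- `tr(adj S₀ · M) ≤ 0` with `S₀ ≻ 0` forbids `M ≻ 0` (Schur: `tr(P·Q) > 0` for definite `P = adj S₀`, `Q = M`). [folklore] -/
theorem not_posDef_of_trace_adjugate_mul_nonpos {S₀ M : Matrix (Fin 3) (Fin 3) ℝ} (hP : S₀.PosDef)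
    (h : (S₀.adjugate * M).trace ≤ 0) : ¬ M.PosDef :=
  fun hM => absurd (trace_mul_pos_of_posDef (adjugate_posDef_of_posDef hP) hM) (not_lt.2 h)

/-- `0 ≤ tr(adj S₀ · M)` with `S₀ ≻ 0` forbids `−M ≻ 0`. [folklore] -/
theorem not_neg_posDef_of_trace_adjugate_mul_nonneg {S₀ M : Matrix (Fin 3) (Fin 3) ℝ} (hP : S₀.PosDef)
    (h : 0 ≤ (S₀.adjugate * M).trace) : ¬ (-M).PosDef := fun hM => by
  have := trace_mul_pos_of_posDef (adjugate_posDef_of_posDef hP) hM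
  rw [Matrix.mul_neg, Matrix.trace_neg] at this
  linarith

/-- `tr(adj M · S₀) ≤ 0` with `S₀ ≻ 0` forbids `−M ≻ 0` (`adj(−M) = adj M ≻ 0` for a `3 × 3` negative definite `M`). [folklore] -/
theorem not_neg_posDef_of_trace_adjugate_self_mul_nonpos {S₀ M : Matrix (Fin 3) (Fin 3) ℝ} (hP : S₀.PosDef)
    (h : (M.adjugate * S₀).trace ≤ 0) : ¬ (-M).PosDef :=
  fun hM => absurd (trace_mul_pos_of_posDef (adjugate_posDef_of_neg_posDef hM) hP) (not_lt.2 h)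

/-- `adj (−M) = adj M` for `3 × 3` matrices. [folklore] -/
theorem adjugate_neg_fin_three (M : Matrix (Fin 3) (Fin 3) ℝ) : (-M).adjugate = M.adjugate := by
  rw [← neg_one_smul ℝ M, Matrix.adjugate_smul]; simp

/-- `det (−M) = − det M` for `3 × 3` matrices. [folklore] -/
theorem det_neg_fin_three (M : Matrix (Fin 3) (Fin 3) ℝ) : (-M).det = -M.det := by
  rw [Matrix.det_neg]; simp [Fintype.card_fin]; norm_num

/-! ## 3. THE INERTIA TABLE (symmetric letters, positive definite bottom letter, nine positive roots) -/

section Inertia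

variable (d : Fin 3 → ℕ) (S : Fin 3 → Matrix (Fin 3) (Fin 3) ℝ) (hS : ∀ l, (S l).IsSymm)
  (h9 : 9 ≤ ((Matrix.det (∑ l, ((X : ℝ[X]) ^ d l) • (S l).map C)).roots.toFinset.filter (fun t => 0 < t)).card)
  (h0 : d 0 = 0) (hP : (S 0).PosDef)
include hS h9 h0 hP

/-- **INERTIA, chamber I (`3d₁ < d₂`, `κ < 1/2`)**: the middle letter is NEGATIVE DEFINITE, `−S₁ ≻ 0`, and the top letter has inertia `(2,1)`
(`det S₂ < 0`, `−S₂ ⊁ 0`) — the sign data of report G13 §2f's corollary (all-middle law with a definite bottom letter). [folklore] -/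
theorem inertia_chamber_I (hI : 3 * d 1 < d 2) (h1 : 0 < d 1) :
    (-S 1).PosDef ∧ ((S 2).det < 0 ∧ ¬ (-S 2).PosDef) := by
  obtain ⟨t1, t2, t3, t4, -, -, -, -, t9⟩ := signs_chamber_I d S h9 h0 hP.det_pos hI h1
  refine ⟨posDef_of_pencil_invariants_pos hP (hS 1).neg ?_ ?_ ?_, t9, not_neg_posDef_of_trace_adjugate_mul_nonneg hP t4.le⟩
  · rw [Matrix.mul_neg, Matrix.trace_neg]; linarith
  · rw [adjugate_neg_fin_three]; exact t2
  · rw [det_neg_fin_three]; linarith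

omit hS in
/-- **INERTIA, chamber II (`2d₁ < d₂ < 3d₁`, `κ ∈ (1/2,1)`)**: `S₁` has inertia `(1,2)` (`det S₁ > 0`, `S₁ ⊁ 0`) and `S₂` inertia `(2,1)`
(`det S₂ < 0`, `−S₂ ⊁ 0`). [folklore] -/
theorem inertia_chamber_II (hIIa : 2 * d 1 < d 2) (hIIb : d 2 < 3 * d 1) :
    (0 < (S 1).det ∧ ¬ (S 1).PosDef) ∧ ((S 2).det < 0 ∧ ¬ (-S 2).PosDef) := by
  obtain ⟨t1, -, -, t3, -, -, t7, -, t9⟩ := signs_chamber_II d S h9 h0 hP.det_pos hIIa hIIb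
  exact ⟨⟨t3, not_posDef_of_trace_adjugate_mul_nonpos hP t1.le⟩, t9, not_neg_posDef_of_trace_adjugate_self_mul_nonpos hP t7.le⟩

omit hS in
/-- **INERTIA, chamber III (`3d₁ < 2d₂`, `d₂ < 2d₁`, `κ ∈ (1,2)` — the pure-λ_min chamber)**: BOTH `S₁` and `S₂` have inertia `(2,1)`
(`det < 0`, `−S ⊁ 0`) (report G7 §5 / G15 §3e sign pattern, now for every positive definite `S₀`). [folklore] -/
theorem inertia_chamber_III (hIIIa : 3 * d 1 < 2 * d 2) (hIIIb : d 2 < 2 * d 1) :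
    ((S 1).det < 0 ∧ ¬ (-S 1).PosDef) ∧ ((S 2).det < 0 ∧ ¬ (-S 2).PosDef) := by
  obtain ⟨-, t2, t3, -, t5, -, -, -, t9⟩ := signs_chamber_III d S h9 h0 hP.det_pos hIIIa hIIIb
  exact ⟨⟨t5, not_neg_posDef_of_trace_adjugate_self_mul_nonpos hP t3.le⟩, t9, not_neg_posDef_of_trace_adjugate_mul_nonneg hP t2.le⟩

omit hS in
/-- **INERTIA, chamber IV (`d₁ < d₂`, `2d₂ < 3d₁`, `κ > 2`)**: `S₁` has inertia `(1,2)` (`det S₁ > 0`, `S₁ ⊁ 0`), `S₂` inertia `(2,1)`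
(`det S₂ < 0`, `−S₂ ⊁ 0`). [folklore] -/
theorem inertia_chamber_IV (h12 : d 1 < d 2) (hIV : 2 * d 2 < 3 * d 1) :
    (0 < (S 1).det ∧ ¬ (S 1).PosDef) ∧ ((S 2).det < 0 ∧ ¬ (-S 2).PosDef) := by
  obtain ⟨t1, t2, -, -, -, t6, -, -, t9⟩ := signs_chamber_IV d S h9 h0 hP.det_pos h12 hIV
  exact ⟨⟨t6, not_posDef_of_trace_adjugate_mul_nonpos hP t1.le⟩, t9, not_neg_posDef_of_trace_adjugate_mul_nonneg hP t2.le⟩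

/-- **Summary row (all supports): the TOP letter of a definite-bottom nine-row always has inertia `(2,1)`** — `det S₂ < 0` and `−S₂ ⊁ 0`
whenever `S₀ ≻ 0`, `d 0 = 0 < d 1 < d 2` and `Z₊ ≥ 9` (g8's located «n₋(S₂) = 1 always», now a theorem; the three walls carry no nine-row,
`NineInertia.walls_of_nine`). [folklore] -/
theorem top_letter_inertia (h1 : 0 < d 1) (h12 : d 1 < d 2) : (S 2).det < 0 ∧ ¬ (-S 2).PosDef := by
  obtain ⟨w1, w2, w3⟩ := walls_of_nine d S h9 h0
  rcases lt_or_gt_of_ne w1 with hI | hI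
  · exact (inertia_chamber_I d S hS h9 h0 hP hI h1).2
  rcases lt_or_gt_of_ne w2 with hII | hII
  · exact (inertia_chamber_II d S h9 h0 hP hII hI).2
  rcases lt_or_gt_of_ne w3 with hIII | hIV
  · exact (inertia_chamber_IV d S h9 h0 hP h12 hIII).2
  · exact (inertia_chamber_III d S h9 h0 hP hIV hII).2

omit hS in
/-- **Summary row: the MIDDLE letter of a definite-bottom nine-row is never positive definite** (all supports; in chamber I it is in fact
negative definite, `inertia_chamber_I`). [folklore] -/
theorem middle_letter_not_posDef (h1 : 0 < d 1) (h12 : d 1 < d 2) : ¬ (S 1).PosDef := by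
  obtain ⟨w1, w2, w3⟩ := walls_of_nine d S h9 h0
  rcases lt_or_gt_of_ne w1 with hI | hI
  · exact not_posDef_of_trace_adjugate_mul_nonpos hP (signs_chamber_I d S h9 h0 hP.det_pos hI h1).1.le
  rcases lt_or_gt_of_ne w2 with hII | hII
  · exact not_posDef_of_trace_adjugate_mul_nonpos hP (signs_chamber_II d S h9 h0 hP.det_pos hII hI).1.le
  rcases lt_or_gt_of_ne w3 with hIII | hIV
  · exact not_posDef_of_trace_adjugate_mul_nonpos hP (signs_chamber_IV d S h9 h0 hP.det_pos h12 hIII).1.le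
  · exact not_posDef_of_trace_adjugate_mul_nonpos hP (signs_chamber_III d S h9 h0 hP.det_pos hIV hII).1.le

end Inertia

end NineInertia

end Summit.ValiantsHypothesis.ValiantsHypothesis.Theorems.LacunarySymmetroidMatrixDescartes.Census
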